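import Literature.NumberTheory.EllipticCurves.NeronLocalHeightPotentialGoodReduction
import HarnessLib

/-!
# Potential good reduction is attained over a number field: `|j(E)|_p ≤ 1` ⇒ `E ×_ℚ L` has good
# reduction at some place `w ∣ p` of a number field `L` (Silverman AEC VII.5.4–5.5; Serre–Tate §2)

Topic `NumberTheory/EllipticCurves`; theorems only (no definition, no named fact, no instance).

For an elliptic curve `E/ℚ` (any Weierstrass equation `W`) and a rational prime `p` with `|j(W)|_p ≤ 1`
(integral `j` at `p` ⟺ potential good reduction, Silverman AEC VII.5.5), there are a number field `L` and a place
`w ∣ p` of `L` at which `E ×_ℚ L` has GOOD reduction (`WeierstrassCurve.HasGoodReductionAt`):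
`exists_numberField_hasGoodReductionAt_of_padicAbv_j_le_one` (place `v` of `ℤ`),
`exists_numberField_hasGoodReductionAt_of_padicNorm_j_le_one` (rational prime `p`). This is Steps 1–3 of the proof of
`neronLocalHeight_padicAbv_nonneg_of_padicAbv_j_le_one` (file `NeronLocalHeightPotentialGoodReduction`), made a
statement of its own: the semistable reduction theorem over a finite extension (tree
`WeierstrassCurve.exists_finite_isSemistable_holds`, AEC VII.5.4), a place `w` above `p`, and the exclusion of
multiplicative reduction at `w` by `|j|_w ≤ 1` (`one_lt_norm_j_of_hasMultiplicativeReductionAt`, AEC VII.5.1(b)) after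
Ostrowski's identification of the restriction of `‖·‖_w` to `ℚ`.

Motivation: the number-field witness asked by `WeierstrassCurve.HasPotentiallyGoodOrdinaryReductionAtPrime` /
`TypeG` (BSD cells; crux K★ `stmt-BirchSwinnertonDyer-22226`, hDR sector programme item (c)) — here the good
reduction half; the unit-root (ordinary) half depends on the curve.

## References

* [SilvermanAEC2009] J. H. Silverman, *AEC* (2009), Prop. VII.5.1(b), Prop. VII.5.4, Prop. VII.5.5.
* [SerreTate1968] J.-P. Serre, J. Tate, *Good reduction of abelian varieties*, Ann. of Math. 88 (1968), §2.
-/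

noncomputable section

open scoped Classical NumberField

namespace Literature.NumberTheory.EllipticCurves

open IsDedekindDomain Rat.HeightOneSpectrum
open _root_.WeierstrassCurve

/-- Over every rational prime `p` there is a finite place of the number field `L`. (Private copy of the going-up
lemma of `NeronLocalHeightPotentialGoodReduction.lean`.) [folklore] -/
private theorem exists_place_natCast_mem'' {L : Type*} [Field L] [NumberField L] {p : ℕ} (hp : p.Prime) :
    ∃ w : HeightOneSpectrum (𝓞 L), (p : 𝓞 L) ∈ w.asIdeal := by
  have hpZ : Prime (p : ℤ) := Nat.prime_iff_prime_int.mp hp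
  haveI hpI : (Ideal.span {(p : ℤ)}).IsMaximal :=
    ((Ideal.span_singleton_prime hpZ.ne_zero).mpr hpZ).isMaximal (by simpa using hpZ.ne_zero)
  obtain ⟨Q, hQmax, hQover⟩ :=
    Ideal.exists_maximal_ideal_liesOver_of_isIntegral (S := 𝓞 L) (Ideal.span {(p : ℤ)})
  have hQne : Q ≠ ⊥ := by
    rintro rfl
    have h1 : Ideal.span {(p : ℤ)} = Ideal.comap (algebraMap ℤ (𝓞 L)) ⊥ := hQover.over
    rw [Ideal.comap_bot_of_injective (algebraMap ℤ (𝓞 L)) (RingHom.injective_int _)] at h1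
    exact hpZ.ne_zero (Ideal.span_singleton_eq_bot.mp h1)
  refine ⟨⟨Q, hQmax.isPrime, hQne⟩, ?_⟩
  have h1 : (p : ℤ) ∈ Q.under ℤ := hQover.over ▸ Ideal.mem_span_singleton_self _
  simpa using h1

/-- **Potential good reduction is attained over a number field** (AEC VII.5.4–5.5): if `|j(W)|_v ≤ 1` at the place
`v` of `ℤ`, there are a number field `L` and a place `w` of `L` above `p_v` at which `W ×_ℚ L` has good reduction.
[cite: SilvermanAEC2009, Prop. VII.5.4 and Prop. VII.5.5] [cite: SerreTate1968, §2] -/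
theorem exists_numberField_hasGoodReductionAt_of_padicAbv_j_le_one (W : WeierstrassCurve ℚ) [W.IsElliptic]
    (v : HeightOneSpectrum ℤ) (hj : padicAbv v W.j ≤ 1) :
    ∃ (L : Type) (_ : Field L) (_ : NumberField L) (w : HeightOneSpectrum (𝓞 L)),
      (natGenerator v : 𝓞 L) ∈ w.asIdeal ∧ (W.baseChange L).HasGoodReductionAt w := by
  -- Step 1: a number field `L` over which `W` is semistable
  obtain ⟨L, _instF, _instA, _instFD, _instSep, _instAZ, _instST, hsemi⟩ :=
    W.exists_finite_isSemistable_holds (A := ℤ)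
  haveI : CharZero L := charZero_of_injective_algebraMap (algebraMap ℚ L).injective
  obtain rfl : _instA = DivisionRing.toRatAlgebra := Subsingleton.elim _ _
  obtain rfl : _instAZ = Ring.toIntAlgebra L := Subsingleton.elim _ _
  haveI : NumberField L := @NumberField.mk L _ _ _instFD
  haveI : IsScalarTower ℤ (𝓞 L) L := IsScalarTower.of_algebraMap_eq fun z => by simp
  have hss : (W.baseChange L).IsSemistable (𝓞 L) := hsemi (𝓞 L)
  -- Step 2: a place `w` of `L` above `p = p_v`
  set p : ℕ := natGenerator v with hp
  have hprime : p.Prime := prime_natGenerator v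
  obtain ⟨w, hpw⟩ := exists_place_natCast_mem'' (L := L) hprime
  let Kw := w.adicCompletion L
  let abw : AbsoluteValue Kw ℝ := NormedField.toAbsoluteValue Kw
  have hna : IsNonarchimedean abw := fun x y => IsUltrametricDist.norm_add_le_max x y
  let vL : AbsoluteValue L ℝ := abw.comp (algebraMap L Kw).injective
  let vQ : AbsoluteValue ℚ ℝ := vL.comp (algebraMap ℚ L).injective
  have hvQ_apply : ∀ x : ℚ, vQ x = ‖algebraMap L Kw (algebraMap ℚ L x)‖ := fun x => rfl
  have hvQna : IsNonarchimedean vQ := by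
    intro x y
    rw [hvQ_apply, hvQ_apply, hvQ_apply, map_add, map_add]
    exact hna _ _
  have hvQp : vQ p < 1 := by
    rw [hvQ_apply, map_natCast (algebraMap ℚ L), Valued.toNormedField.norm_lt_one_iff,
      WeierstrassCurve.valued_algebraMap_adicCompletion]
    have e1 : (p : L) = algebraMap (𝓞 L) L (p : 𝓞 L) := by simp
    rw [e1]
    exact (HeightOneSpectrum.valuation_lt_one_iff_mem _ _).mpr hpw
  -- Ostrowski: `vQ ^ c = |·|_v`
  obtain ⟨c, hc, hcv⟩ := exists_rpow_eq_padicAbv v hvQna hvQp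
  -- Step 3: good reduction at `w` (multiplicative is excluded by `|j|_w ≤ 1`)
  haveI : (W.baseChange L).IsElliptic := inferInstanceAs (W.map _).IsElliptic
  have hjw : ‖algebraMap L Kw (W.baseChange L).j‖ ≤ 1 := by
    have h1 : (W.baseChange L).j = algebraMap ℚ L W.j := W.map_j _
    rw [h1, ← hvQ_apply]
    have h2 : vQ W.j ^ c ≤ 1 ^ c := by rw [hcv, Real.one_rpow]; exact hj
    exact (Real.rpow_le_rpow_iff (vQ.nonneg _) zero_le_one hc).mp h2
  have hgood : (W.baseChange L).HasGoodReductionAt w := by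
    rcases hss w with hg | hm
    · exact hg
    · exact absurd hjw (not_le.mpr (one_lt_norm_j_of_hasMultiplicativeReductionAt w _ hm))
  exact ⟨L, inferInstance, inferInstance, w, hpw, hgood⟩

/-- **Potential good reduction over a number field, for a rational prime `p`**: if `‖j(W)‖_p ≤ 1` (`padicNorm`), there are
a number field `L` and a place `w ∣ p` of `L` at which `W ×_ℚ L` has good reduction.
[cite: SilvermanAEC2009, Prop. VII.5.4 and Prop. VII.5.5] [cite: SerreTate1968, §2] -/
theorem exists_numberField_hasGoodReductionAt_of_padicNorm_j_le_one (W : WeierstrassCurve ℚ) [W.IsElliptic]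
    (p : ℕ) [hp : Fact p.Prime] (hj : padicNorm p W.j ≤ 1) :
    ∃ (L : Type) (_ : Field L) (_ : NumberField L) (w : HeightOneSpectrum (𝓞 L)),
      (p : 𝓞 L) ∈ w.asIdeal ∧ (W.baseChange L).HasGoodReductionAt w := by
  set v : HeightOneSpectrum ℤ := (Rat.HeightOneSpectrum.primesEquiv (R := ℤ)).symm ⟨p, hp.out⟩ with hv_def
  have hgen : natGenerator v = p := by
    change ((Rat.HeightOneSpectrum.primesEquiv v : Nat.Primes) : ℕ) = p
    rw [hv_def, Equiv.apply_symm_apply]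
  have hj' : padicAbv v W.j ≤ 1 := by
    rw [padicAbv_apply, hgen]
    exact_mod_cast hj
  obtain ⟨L, _, _, w, hpw, hgood⟩ := exists_numberField_hasGoodReductionAt_of_padicAbv_j_le_one W v hj'
  rw [hgen] at hpw
  exact ⟨L, inferInstance, inferInstance, w, hpw, hgood⟩

end Literature.NumberTheory.EllipticCurves

end
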